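import Summits.BirchSwinnertonDyer.BirchSwinnertonDyer.Theorems.KolyvaginRankRigidityAtTwoClassesIntoSelmerBadDefect
import Summits.BirchSwinnertonDyer.BirchSwinnertonDyer.Theorems.KolyvaginRankRigidityAtTwoClassesIntoSelmerGood
import Summits.BirchSwinnertonDyer.BirchSwinnertonDyer.Theorems.ErratumRoadFiveShimuraKolyvaginOrderBoundInertLocalAll
import HarnessLib

/-!
# Crux V2♭ `KolyvaginCorankLowerBoundAtTwo` (stmt-BirchSwinnertonDyer-24623), line `kolyvagin_depth_split`
# (LEAD krr2-p1 g6 reshape, 06:56Z), stub T2 `stub_selmerAwayFromConductor` — PROVED, GZ-free and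
# unconditionally: a UNIFORM `t` with `2^t • c_M(n) ∈ Sel_v` at every finite place `v ∤ n`

Width prover `bsd-line-krr2-p2` (g5); `--supports stmt-BirchSwinnertonDyer-24623` (registered stub).
THEOREMS ONLY (no definition, no named fact, no `sorry`). BSD is not proved by any of this; nothing about
Kolyvagin's structure theorem at `2` is asserted — this is the "Selmer away from the conductor" plumbing
with the bounded `2`-power defect that even Tamagawa numbers force.

## Proof (Gross 1991 Prop. 6.2 (1) at `p = 2`, GZ-free)

For a concrete datum `d` at a Kolyvagin level `n` (odd, prime to `N_E`) and a finite place `v ∤ n`: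
* junk branch of `d.kolyvaginClass`: the class is `0`;
* good `v`: `c_M(n) ∈ Sel_v` outright (`kolyvaginClass_mem_selmerLocalKer_of_hasGoodReductionAt`, Milne
  *ADT* I.3.8; krr2-p2 `ClassesIntoSelmerGood`);
* bad `v`: local inertia at `v ∤ n` fixes ALL of `E(K[n]) ⊆ E(K̄)`
  (`smul_toGeomPoints_eq_self_of_mem_localInertia`, Cox §9.A), so McCallum's root `(σ−1)P(n)/2^M ∈ E(K[n])`
  is inertia-fixed and the Kodaira–Néron exponent `c_v` (`= ord_v Δ_min(E/K)` at a node,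
  `0 < c_v ≤ 4` at a cusp — x11b3's `ordMinimalDiscriminant_nsmul_mem_E0Receptacle`,
  `exists_nsmul_mem_E0Receptacle_le_four`, Silverman VII.6.1) pushes its local image into `E⁰(K̄_v)`;
  by the coprimality-free mechanism (`zsmul_kolyvaginClass_mem_selmerLocalKer_of_inertia_of_zsmul_mem`,
  krr2-p2 `ClassesIntoSelmerBadDefect`) and `H¹(K_v^{un}/K_v, E⁰) = 0`
  (`oneCocycleClass_eq_zero_of_mem_E0Receptacle`) one gets **`c_v • c_M(n) ∈ Sel_v`** — for every prime
  `p`, with no [GZ86 III (3.1)] and no parity of `c_v`;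
* at `p = 2`: `c_M(n)` is `2^M`-torsion, so the odd part of `c_v` is stripped (Bézout) and
  `2^{v₂(c_v)} • c_M(n) ∈ Sel_v`; uniformly `v₂(c_v) < c_v ≤ max(4, ord_v Δ_min(E/K))`, and at a bad
  place `v ∣ ℓ ∣ N_E` the prime `ℓ` SPLITS in `K` (Heegner hypothesis), so
  `ord_v Δ_min(E/K) = ord_ℓ Δ_min(E/ℚ) ≤ |Δ_min(E/ℚ)|` (shim-p1's
  `kodairaSymbolAt_and_ordMinimalDiscriminant_baseChange_eq_of_split`, Silverman VII.5.4 (a)); hence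
  `t := |Δ_min(E/ℚ)| + 4` works for all `n, d, M, v`.

Main statements: `zsmul_kolyvaginClass_mem_selmerLocalKer_of_inertiaFixed_of_nsmul_mem_E0Receptacle`
(any `p`, abstract module), `natCast_zsmul_kolyvaginClass_mem_selmerLocalKer_of_not_hasGoodReductionAt`
(any `p`, concrete datum, bad `v ∤ n`: `c_v • c_M(n) ∈ Sel_v`), `pow_zsmul_kolyvaginClass_two_mem_selmerLocalKer`
(`p = 2`, uniform `t`), and the registered stub `stub_selmerAwayFromConductor` VERBATIM.

References (locators only): [cite: GrossLMS1991, §6 Prop. 6.2 (1) (pp. 244–245), §4 Lemma 4.3]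
[cite: McCallumLMS1991, §4 Cor. 4.2, Lemma 4.3] [cite: MilneADT2006, Ch. I Prop. 3.8]
[cite: SilvermanAEC2009, Thm. VII.6.1, Cor. VII.6.2, Prop. VII.5.4 (a)] [cite: Cox2013, §9.A].
-/

set_option autoImplicit false
-- the Theorems namespace of this sub repeats the summit name by design (D-0017 nested layout)
set_option linter.dupNamespace false

noncomputable section

open scoped Classical
open scoped AddSubgroup

namespace Summit.BirchSwinnertonDyer.BirchSwinnertonDyer.Theorems.KolyvaginRankRigidity

open WeierstrassCurve NumberField IsDedekindDomain Field
  Literature.NumberTheory.EllipticCurves Literature.NumberTheory.GaloisRepresentations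
  Literature.NumberTheory.EllipticCurves.KolyvaginCocycle
  Literature.NumberTheory.EllipticCurves.ModularForms
  Summit.BirchSwinnertonDyer.Rank1Residual.X11b Summit.BirchSwinnertonDyer.Rank1Residual.X11b.Three
  Summit.BirchSwinnertonDyer.Rank1Residual.X11b.Three.GrossBadPlace

universe u

/-! ## §1 Any prime: `c_v • c(P) ∈ Sel_v` for an inertia-fixed module and a Kodaira–Néron exponent `c_v` -/

section Abstract

variable {K : Type u} [Field K] [NumberField K]

/-- **Gross's Prop. 6.2 (1) at a bad place for an inertia-fixed admissible module, bounded-defect form**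
(shim-p1's `kolyvaginClass_mem_selmerLocalKer_of_inertiaFixed_of_nsmul_mem_E0Receptacle` with the
coprimality of `c` and `n` REMOVED): if the inertia group `I_𝔐` at `v` fixes every point of the admissible
module `A` and the natural number `c` kills every `I_𝔐`-fixed local point into `E⁰(K̄_v)`, then
`c • c(P) ∈ selmerLocalKer X K_v n`. [cite: GrossLMS1991, Prop. 6.2 (1), pp. 244–245]
[cite: McCallumLMS1991, Lemma 4.3] [cite: MilneADT2006, Ch. I Prop. 3.8] -/
theorem zsmul_kolyvaginClass_mem_selmerLocalKer_of_inertiaFixed_of_nsmul_mem_E0Receptacle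
    (X : WeierstrassCurve K) [X.IsElliptic] {n : ℤ}
    {hdiv : ∀ P : geomPoints X, ∃ Q : geomPoints X, n • Q = P}
    {A : AddSubgroup (geomPoints X)} (hA : IsAdmissible (absoluteGaloisGroup K) A n)
    {P : geomPoints X} (hP : P ∈ invPoints (absoluteGaloisGroup K) A n)
    (v : HeightOneSpectrum (𝓞 K)) {𝔐 : Ideal (v.localAbsIntegers)} (h𝔐 : 𝔐 ∈ v.localPrimesAbove)
    (hAfix : ∀ σ ∈ 𝔐.inertia (absoluteGaloisGroup (v.adicCompletion K)), ∀ a ∈ A,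
      resGal (K := K) (v.adicCompletion K) σ • a = a)
    {c : ℕ}
    (hc : ∀ Q : localPoints X (v.adicCompletion K),
      (∀ σ ∈ 𝔐.inertia (absoluteGaloisGroup (v.adicCompletion K)), σ • Q = Q) →
        c • Q ∈ E0Receptacle X v) :
    (c : ℤ) • kolyvaginClass X n hdiv hA P hP ∈ selmerLocalKer X (v.adicCompletion K) n := by
  refine zsmul_kolyvaginClass_mem_selmerLocalKer_of_inertia_of_zsmul_mem X hA hP v
    (fun σ hσ ↦ hAfix σ hσ P hP.1) (E0Receptacle X v) (fun σ ↦ ?_)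
    (fun f hfB hfI ↦ oneCocycleClass_eq_zero_of_mem_E0Receptacle X v h𝔐 f hfB hfI)
  have hr : rootIn A n (resGal (K := K) (v.adicCompletion K) σ • P - P) ∈ A :=
    (rootIn_smul_sub_spec hP _).1
  have hfix : ∀ σ' ∈ 𝔐.inertia (absoluteGaloisGroup (v.adicCompletion K)),
      σ' • pointsMap X (v.adicCompletion K)
          (rootIn A n (resGal (K := K) (v.adicCompletion K) σ • P - P)) =
        pointsMap X (v.adicCompletion K)
          (rootIn A n (resGal (K := K) (v.adicCompletion K) σ • P - P)) :=
    fun σ' hσ' ↦ by rw [← pointsMap_smul, hAfix σ' hσ' _ hr]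
  rw [natCast_zsmul]
  exact hc _ hfix

/-- **A Kodaira–Néron exponent exists at every bad place, with no primality condition** (Silverman
VII.6.1 over `K_v^{nr}`): `c = ord_v(Δ_min)` at a node, `0 < c ≤ 4` at a cusp; in both cases
`0 < c ≤ max 4 (ord_v Δ_min)` and `c` kills the `I_𝔐`-fixed local points into `E⁰(K̄_v)`.
[cite: SilvermanAEC2009, Thm. VII.6.1, Cor. VII.6.2] -/
theorem exists_nsmul_mem_E0Receptacle_of_not_hasGoodReductionAt (X : WeierstrassCurve K) [X.IsElliptic]
    (v : HeightOneSpectrum (𝓞 K)) (hbad : ¬ X.HasGoodReductionAt v)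
    {𝔐 : Ideal (v.localAbsIntegers)} (h𝔐 : 𝔐 ∈ v.localPrimesAbove) :
    ∃ c : ℕ, 0 < c ∧ c ≤ max 4 (X.ordMinimalDiscriminant v) ∧
      ∀ Q : localPoints X (v.adicCompletion K),
        (∀ σ ∈ 𝔐.inertia (absoluteGaloisGroup (v.adicCompletion K)), σ • Q = Q) →
          c • Q ∈ E0Receptacle X v := by
  rcases hasGoodReductionAt_or_hasMultiplicativeReductionAt_or_hasAdditiveReductionAt v X with
    hgood | hm | ha
  · exact absurd hgood hbad
  · refine ⟨X.ordMinimalDiscriminant v, Nat.pos_of_ne_zero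
      (WeierstrassCurve.ordMinimalDiscriminant_ne_zero_of_hasMultiplicativeReductionAt (W := X) (v := v) hm),
      le_max_right _ _, fun Q hQ ↦ ordMinimalDiscriminant_nsmul_mem_E0Receptacle X v hm h𝔐 hQ⟩
  · obtain ⟨c, hc0, hc4, hcE⟩ := exists_nsmul_mem_E0Receptacle_le_four X v ha h𝔐
    exact ⟨c, hc0, hc4.trans (le_max_left _ _), fun Q hQ ↦ hcE Q hQ⟩

/-- **Stripping the odd part of the defect against a `2`-power annihilator**: in an additive group, if
`c • x ∈ S`, `2^M • x = 0` and `c = 2^k · u` with `u` odd, then `2^k • x ∈ S` (Bézout for `u` and `2^M`).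
[folklore] -/
theorem two_pow_zsmul_mem_of_mul_odd_zsmul_mem {G : Type*} [AddCommGroup G] (S : AddSubgroup G) {x : G}
    {M k u : ℕ} (hu : Odd u) (hS : ((2 ^ k * u : ℕ) : ℤ) • x ∈ S) (hM : ((2 ^ M : ℕ) : ℤ) • x = 0) :
    ((2 ^ k : ℕ) : ℤ) • x ∈ S := by
  have hcop : IsCoprime (u : ℤ) ((2 ^ M : ℕ) : ℤ) := by
    rw [Int.isCoprime_iff_gcd_eq_one, Int.gcd_natCast_natCast]
    exact (Nat.coprime_two_right.mpr hu).pow_right M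
  obtain ⟨a, b, hab⟩ := hcop
  have h1 : ((2 ^ k : ℕ) : ℤ) =
      a * ((2 ^ k * u : ℕ) : ℤ) + (b * ((2 ^ k : ℕ) : ℤ)) * ((2 ^ M : ℕ) : ℤ) := by
    have h := hab
    push_cast at h ⊢
    linear_combination (-((2 : ℤ) ^ k)) * h
  have h2 : ((2 ^ k : ℕ) : ℤ) • x =
      a • (((2 ^ k * u : ℕ) : ℤ) • x) + (b * ((2 ^ k : ℕ) : ℤ)) • (((2 ^ M : ℕ) : ℤ) • x) := by
    conv_lhs => rw [h1]
    rw [add_zsmul, mul_zsmul, mul_zsmul]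
  rw [h2, hM, zsmul_zero, add_zero]
  exact S.zsmul_mem hS a

end Abstract

/-! ## §2 The concrete class at a bad place `v ∤ n`: `c_v • c_M(n) ∈ Sel_v`, any prime -/

section Concrete

-- `K : Type`: the tree's ring-class class field theory is universe `0`.
variable {K : Type} [Field K] [NumberField K] {N : ℕ} [NeZero N] {W : WeierstrassCurve ℚ}
  {Dt : ModularParametrizationData W N} {β : ℤ} {ι : K →+* ℂ} {n : ℕ}
  (d : KolyvaginHeegnerData Dt β ι n)

/-- **`c_v • c_M(n) ∈ Sel_v` at a bad place `v ∤ n`, any prime `p`, any concrete datum, NO [GZ86 III (3.1)]**: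
`K` imaginary quadratic, `d` at level `n ≥ 1`, `v ∤ n` finite, `c` any natural number killing the
`I_𝔐`-fixed local points into `E⁰(K̄_v)` (`exists_nsmul_mem_E0Receptacle_of_not_hasGoodReductionAt`).
Junk branch: the class is `0`. Admissible branch: inertia at `v ∤ n` fixes `E(K[n])`
(`smul_toGeomPoints_eq_self_of_mem_localInertia`) and §1 applies. [cite: GrossLMS1991, Prop. 6.2 (1)]
[cite: SilvermanAEC2009, Thm. VII.6.1] -/
theorem natCast_zsmul_kolyvaginClass_mem_selmerLocalKer_of_nsmul_mem_E0Receptacle [W.IsElliptic]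
    (hK : IsImaginaryQuadratic K) (hn : n ≠ 0) {p : ℕ} (hp : p.Prime) (M : ℕ)
    (v : HeightOneSpectrum (𝓞 K)) (hv : ((n : ℕ) : 𝓞 K) ∉ v.asIdeal)
    {𝔐 : Ideal (v.localAbsIntegers)} (h𝔐 : 𝔐 ∈ v.localPrimesAbove) {c : ℕ}
    (hc : ∀ Q : localPoints (W.baseChange K) (v.adicCompletion K),
      (∀ σ ∈ 𝔐.inertia (absoluteGaloisGroup (v.adicCompletion K)), σ • Q = Q) →
        c • Q ∈ E0Receptacle (W.baseChange K) v) :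
    (c : ℤ) • d.kolyvaginClass hp M ∈
      selmerLocalKer (W.baseChange K) (v.adicCompletion K) ((p ^ M : ℕ) : ℤ) := by
  haveI : (W.baseChange K).IsElliptic := by rw [baseChange]; infer_instance
  by_cases h : IsAdmissible (absoluteGaloisGroup K) d.pointsSubgroup ((p ^ M : ℕ) : ℤ) ∧
      d.toGeomPoints d.derivedPoint ∈
        invPoints (absoluteGaloisGroup K) d.pointsSubgroup ((p ^ M : ℕ) : ℤ)
  · rw [d.kolyvaginClass_of_admissible hp M h.1 h.2]
    refine zsmul_kolyvaginClass_mem_selmerLocalKer_of_inertiaFixed_of_nsmul_mem_E0Receptacle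
      (W.baseChange K) h.1 h.2 v h𝔐 ?_ hc
    rintro σ hσ _ ⟨P, rfl⟩
    exact smul_toGeomPoints_eq_self_of_mem_localInertia d hK hn hv h𝔐 hσ P
  · rw [KolyvaginHeegnerData.kolyvaginClass, dif_neg h, zsmul_zero]
    exact AddSubgroup.zero_mem _

/-- **`p^M` kills the concrete class `c_M(n)`** (McCallum 1991, Lemma 4.1: the cocycle has values in
`E[p^M]`; junk branch `0`). [cite: McCallumLMS1991, Lemma 4.1] -/
theorem pow_natCast_zsmul_kolyvaginClass_eq_zero {p : ℕ} (hp : p.Prime) (M : ℕ) :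
    ((p ^ M : ℕ) : ℤ) • d.kolyvaginClass hp M = 0 := by
  by_cases h : IsAdmissible (absoluteGaloisGroup K) d.pointsSubgroup ((p ^ M : ℕ) : ℤ) ∧
      d.toGeomPoints d.derivedPoint ∈
        invPoints (absoluteGaloisGroup K) d.pointsSubgroup ((p ^ M : ℕ) : ℤ)
  · rw [d.kolyvaginClass_of_admissible hp M h.1 h.2,
      kolyvaginClass_eq_cls h.1 h.2 (Classical.choose_spec
        ((W.baseChange K).zsmul_geomPoints_surjective_of_charZero
          (by exact_mod_cast pow_ne_zero M hp.ne_zero) (d.toGeomPoints d.derivedPoint)))]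
    exact zsmul_cls_eq_zero h.1 _ h.2 _
  · rw [KolyvaginHeegnerData.kolyvaginClass, dif_neg h, zsmul_zero]

end Concrete

/-! ## §3 `p = 2` on the route's habitat: the uniform `2`-power defect and the registered stub -/

section Two

variable {K : Type} [Field K] [NumberField K]

/-- `v_ℓ(z) ≤ |z|` for a prime `ℓ` and `z ≠ 0` (crude: `ℓ^{v} ∣ |z|`, `v < ℓ^v`). [folklore] -/
theorem padicValInt_le_natAbs {ℓ : ℕ} (hℓ : ℓ.Prime) {z : ℤ} (hz : z ≠ 0) :
    padicValInt ℓ z ≤ z.natAbs := by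
  have h1 : ℓ ^ padicValNat ℓ z.natAbs ∣ z.natAbs := pow_padicValNat_dvd
  have h2 : ℓ ^ padicValNat ℓ z.natAbs ≤ z.natAbs := Nat.le_of_dvd (Int.natAbs_pos.mpr hz) h1
  have h3 : padicValNat ℓ z.natAbs < ℓ ^ padicValNat ℓ z.natAbs := Nat.lt_pow_self hℓ.one_lt
  unfold padicValInt
  omega

/-- **The uniform `2`-power defect.** For `W/ℚ` globally minimal elliptic, `K` imaginary quadratic
with the Heegner hypothesis for `N_E`, a concrete datum `d` at a level `n ≥ 1`, any `M`, and a finite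
place `v ∤ n` of `K`: `2^t • c_M(n) ∈ selmerLocalKer (E/K) K_v 2^M` with the UNIFORM
`t = |Δ_min(E/ℚ)| + 4` — good `v`: no defect; bad `v`: the Kodaira–Néron exponent `c_v` with its odd part
stripped (`c_M(n)` is `2^M`-torsion), and `v₂(c_v) < c_v ≤ max(4, ord_v Δ_min(E/K)) ≤ max(4, |Δ_min(E/ℚ)|)`
because the bad prime `ℓ` below `v` divides `N_E` and therefore SPLITS in `K`
(`kodairaSymbolAt_and_ordMinimalDiscriminant_baseChange_eq_of_split`). No image hypothesis, no parity
of `d_K`, no [GZ86 III (3.1)]. [cite: GrossLMS1991, Prop. 6.2 (1)] [cite: SilvermanAEC2009, Thm. VII.6.1,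
Prop. VII.5.4 (a)] [cite: MilneADT2006, Ch. I Prop. 3.8] -/
theorem pow_zsmul_kolyvaginClass_two_mem_selmerLocalKer (W : WeierstrassCurve ℚ) [W.IsElliptic]
    [W.IsGloballyMinimal] [NeZero (W.conductorNorm ℤ)] (hK : IsImaginaryQuadratic K)
    (hH : SatisfiesHeegnerHypothesis (W.conductorNorm ℤ) K)
    {Dt : ModularParametrizationData W (W.conductorNorm ℤ)} {β : ℤ} {ι : K →+* ℂ} {n : ℕ} (hn : n ≠ 0)
    (d : KolyvaginHeegnerData Dt β ι n) (M : ℕ) (v : HeightOneSpectrum (𝓞 K))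
    (hv : ((n : ℕ) : 𝓞 K) ∉ v.asIdeal) :
    ((2 ^ ((minimalDiscriminantInt W).natAbs + 4) : ℕ) : ℤ) • d.kolyvaginClass Nat.prime_two M ∈
      selmerLocalKer (W.baseChange K) (v.adicCompletion K) ((2 ^ M : ℕ) : ℤ) := by
  set t : ℕ := (minimalDiscriminantInt W).natAbs + 4 with ht
  by_cases hgood : (W.baseChange K).HasGoodReductionAt v
  · exact AddSubgroup.zsmul_mem _
      (kolyvaginClass_mem_selmerLocalKer_of_hasGoodReductionAt d hK hn Nat.prime_two M v hv hgood) _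
  haveI : (W.baseChange K).IsElliptic := by rw [baseChange]; infer_instance
  obtain ⟨𝔐, h𝔐⟩ := v.localPrimesAbove_nonempty
  obtain ⟨c, hc0, hcle, hcE⟩ :=
    exists_nsmul_mem_E0Receptacle_of_not_hasGoodReductionAt (W.baseChange K) v hgood h𝔐
  have hcSel := natCast_zsmul_kolyvaginClass_mem_selmerLocalKer_of_nsmul_mem_E0Receptacle d hK hn
    Nat.prime_two M v hv h𝔐 hcE
  -- `ord_v Δ_min(E/K) = ord_ℓ Δ_min(E/ℚ) ≤ |Δ_min(E/ℚ)|` since `ℓ ∣ N_E` splits in `K`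
  have hsplit := Theorems.kodairaSymbolAt_and_ordMinimalDiscriminant_baseChange_eq_of_split hK W rfl
    (S := (∅ : Finset ℕ)) (fun ℓ hℓ hℓN _ ↦ hH ℓ hℓ hℓN) v hgood (Finset.notMem_empty _)
  have hℓP : (Rat.HeightOneSpectrum.primesEquiv (v.under (𝓞 ℚ)) : ℕ).Prime :=
    (Rat.HeightOneSpectrum.primesEquiv (v.under (𝓞 ℚ))).2
  have hord : (W.baseChange K).ordMinimalDiscriminant v ≤ (minimalDiscriminantInt W).natAbs := by
    rw [hsplit.2.1]
    exact padicValInt_le_natAbs hℓP (minimalDiscriminantInt_ne_zero W)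
  -- strip the odd part of `c`
  obtain ⟨k, u, hu, hck⟩ := Nat.exists_eq_two_pow_mul_odd hc0.ne'
  have hk : k ≤ t := by
    have h2k : 2 ^ k ≤ c := by
      rw [hck]; exact Nat.le_mul_of_pos_right _ (Nat.pos_of_ne_zero fun h0 ↦ by simp [h0] at hu)
    have hklt : k < 2 ^ k := Nat.lt_two_pow_self
    have hcb : c ≤ max 4 ((minimalDiscriminantInt W).natAbs) := hcle.trans (max_le_max le_rfl hord)
    have : max 4 ((minimalDiscriminantInt W).natAbs) ≤ t := by rw [ht]; omega
    omega
  rw [hck] at hcSel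
  have h2k := two_pow_zsmul_mem_of_mul_odd_zsmul_mem _ hu hcSel
    (pow_natCast_zsmul_kolyvaginClass_eq_zero d Nat.prime_two M)
  -- `2^t = 2^(t-k) · 2^k`
  have hpow : ((2 ^ t : ℕ) : ℤ) = ((2 ^ (t - k) : ℕ) : ℤ) * ((2 ^ k : ℕ) : ℤ) := by
    rw [← Nat.cast_mul, ← pow_add, Nat.sub_add_cancel hk]
  rw [hpow, mul_smul]
  exact AddSubgroup.zsmul_mem _ h2k _

/-- **Stub T2 `stub_selmerAwayFromConductor` of the LEAD's reshaped skeleton (krr2-p1 g6, 06:56Z) of line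
`kolyvagin_depth_split` on crux V2♭ `KolyvaginCorankLowerBoundAtTwo` (stmt-BirchSwinnertonDyer-24623),
PROVED VERBATIM** — with the uniform witness `t = |Δ_min(E/ℚ)| + 4` (`pow_zsmul_kolyvaginClass_two_mem_selmerLocalKer`);
most habitat binders (¬CM, reduction at 2, surjectivity, `d_K ≠ −3, −4`, `2 ∤ d_K`, `1 ≤ M ≤ M(n)`) are
idle, only `K` imaginary quadratic, the Heegner hypothesis and `n ≠ 0` (from `KolSupp`) are used.
[cite: GrossLMS1991, §6 Prop. 6.2 (1)] [cite: SilvermanAEC2009, Thm. VII.6.1, Prop. VII.5.4 (a)]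
[cite: MilneADT2006, Ch. I Prop. 3.8] -/
theorem stub_selmerAwayFromConductor :
    ∀ (W : WeierstrassCurve ℚ) [W.IsElliptic] [W.IsGloballyMinimal], ¬ W.HasCM →
      (Rank1Residual.GoodOrd W 2 ∨ Rank1Residual.Mult W 2) →
      (∀ m : ℕ, W.HasSurjectiveModNGaloisRep (2 ^ m : ℕ)) →
      ∀ (K : Type) [Field K] [NumberField K], IsImaginaryQuadratic K → NumberField.discr K ≠ -3 →
        NumberField.discr K ≠ -4 → ¬ ((2 : ℤ) ∣ NumberField.discr K) → ∀ [NeZero (W.conductorNorm ℤ)],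
        SatisfiesHeegnerHypothesis (W.conductorNorm ℤ) K →
        ∀ (Dt : ModularParametrizationData W (W.conductorNorm ℤ)) (β : ℤ) (ι : K →+* ℂ),
          ∃ t : ℕ, ∀ (n : ℕ) (d : KolyvaginHeegnerData Dt β ι n) (M : ℕ),
            KolyvaginDescent.KolSupp (Zhang2014.IsKolyvaginPrime (W.conductorNorm ℤ) W K 2) n →
            1 ≤ M → (M : ℕ∞) ≤ Zhang2014.levelIndex W 2 n →
            ∀ v : HeightOneSpectrum (𝓞 K), ((n : ℕ) : 𝓞 K) ∉ v.asIdeal →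
              ((2 ^ t : ℕ) : ℤ) • d.kolyvaginClass Nat.prime_two M ∈
                selmerLocalKer (W.baseChange K) (v.adicCompletion K) ((2 ^ M : ℕ) : ℤ) := by
  intro W _ _ _ _ _ K _ _ hK _ _ _ _ hH Dt β ι
  exact ⟨(minimalDiscriminantInt W).natAbs + 4, fun n d M hn _ _ v hv ↦
    pow_zsmul_kolyvaginClass_two_mem_selmerLocalKer W hK hH hn.1.ne_zero d M v hv⟩

end Two

end Summit.BirchSwinnertonDyer.BirchSwinnertonDyer.Theorems.KolyvaginRankRigidity

end
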